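import Summits.HodgeConjecture.HodgeConjecture.Theses.HeckePrymWeil
import Literature.AlgebraicGeometry.Motives.HyperbolicWeilType
import Literature.AlgebraicGeometry.HodgeTheory.DirectImageTransport
import Literature.AlgebraicGeometry.HodgeTheory.DirectImageEndomorphism
import Literature.AlgebraicGeometry.HodgeTheory.WeilFamilyBalanced
import Literature.AlgebraicGeometry.HodgeTheory.FlatSectionNonvanishing
import Literature.AlgebraicGeometry.HodgeTheory.WeilFamilyKAction
import Literature.AlgebraicGeometry.HodgeTheory.QbarFamilyLocalSystem
import Literature.NumberTheory.Transcendental.AnalytificationConnectedProofs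
import HarnessLib

/-!
# Hyperbolic Weil type is constant along a `√-7` Weil family of sixfolds (`stub_hyperbolicFlat`)

Route `HeckePrymWeil` (sub-problem `HodgeConjecture`), crux `WeilSixfoldsSqrtMinus7`
(stmt-HodgeConjecture-1260), line `semihomogeneous-perry-design`, registered Stub 5
`stub_hyperbolicFlat` of the skeleton `Cruxes/WeilSixfoldsSqrtMinus7/Lines/semihomogeneous_perry_design.lean`,
proved verbatim (supporting file; it does not close the item).

Along a smooth projective family `f : 𝒳 ⟶ S` of relative dimension `6` over a smooth irreducible
quasi-projective base, with a global endomorphism `g` over `S` and a global class `Θ ∈ H²(𝒳(ℂ); ℂ)`,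
for two fibres with abelian charts `e : A ≅ 𝒳_s`, `e' : A' ≅ 𝒳_{s'}` intertwining `g` with `φ`, `φ'`:
if `(A, φ, e^*Θ_s)` is of hyperbolic Weil type (`Motives.IsHyperbolicWeilType A φ 3 _`: a rational,
`ℂ`-independent, `φ^*`-stable `6`-frame `u` of `H¹(A(ℂ); ℂ)` pairwise isotropic for
`Q_h(x, y) = h⁵ ⌣ (x ⌣ y)`), then so is `(A', φ', e'^*Θ_{s'})`.

Proof (all ingredients are theorems of the tree).  `S(ℂ)` is a connected (SGA1 XII 2.4) topological
manifold, hence path connected, and `R• f_* ℂ` is a local system on it (Ehresmann,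
`isCohomologicallyLocallyTrivialOn_univ_of_isSmoothProjectiveFamily`).  Parallel transport `γ_*` along a
path from `s` to `s'` is `ℂ`-linear (`transportLinear`) and injective (`transportFun_injective`), preserves
rational classes (`isRationalClass_transportFun_of_isSmoothProjectiveFamily`), commutes with the fibre maps
`g_s`, `g_{s'}` of the global `g` (`transportFun_map_fiberHom`) and with the polarization pairings of the
restrictions `Θ_s`, `Θ_{s'}` of the GLOBAL class `Θ` (`transportFun_polarizationPairingOne`); the charts
move frames between `A`, `A'` and the fibres (`map_polarizationPairingOne`, functoriality of `complexBetti`).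
Hence the injective linear map `L := e'^* ∘ γ_* ∘ e^{-1 *} : H¹(A) → H¹(A')` carries the hyperbolic frame
`u` of `(A, φ, e^*Θ_s)` to a hyperbolic frame `L ∘ u` of `(A', φ', e'^*Θ_{s'})`:
`φ'^* (L uᵢ) = L (φ^* uᵢ)` and `Q_{e'^*Θ_{s'}}(L uᵢ, L uⱼ) = e'^* γ_* e^{-1 *} Q_{e^*Θ_s}(uᵢ, uⱼ) = 0`.
No `sorry`, no new definition, no named fact; the hypotheses `A.dim = 6`, `φ² = -7`, rationality of
`Θ_s` are part of the registered signature and not used.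
-/

noncomputable section

set_option linter.dupNamespace false

open CategoryTheory AlgebraicGeometry Limits
open Literature.AlgebraicGeometry Literature.AlgebraicGeometry.Motives
  Literature.AlgebraicGeometry.HodgeTheory
open Literature.AlgebraicTopology.SingularHomology

namespace Summit.HodgeConjecture.HodgeConjecture.Theorems.HeckePrymWeilLine.SemihomogeneousPerryDesign

/-! ### Bookkeeping on `complexBetti` along isomorphisms -/

/-- Round trip along an isomorphism of `ℂ`-schemes: `e.hom^* (e.inv^* x) = x` on `Hᵏ(X(ℂ); ℂ)`.
[cite: FultonYoungTableaux1997, Appendix B §B.1 (1)] -/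
private theorem map_hom_map_inv_apply {X Y : SchemeOver ℂ} (e : X ≅ Y) (k : ℕ)
    (x : complexBetti X k) : complexBetti.map e.hom k (complexBetti.map e.inv k x) = x := by
  rw [← CategoryTheory.comp_apply, ← complexBetti.map_comp, Iso.hom_inv_id, complexBetti.map_id,
    CategoryTheory.id_apply]

/-- Round trip along an isomorphism of `ℂ`-schemes: `e.inv^* (e.hom^* y) = y` on `Hᵏ(Y(ℂ); ℂ)`.
[cite: FultonYoungTableaux1997, Appendix B §B.1 (1)] -/
private theorem map_inv_map_hom_apply {X Y : SchemeOver ℂ} (e : X ≅ Y) (k : ℕ)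
    (y : complexBetti Y k) : complexBetti.map e.inv k (complexBetti.map e.hom k y) = y := by
  rw [← CategoryTheory.comp_apply, ← complexBetti.map_comp, Iso.inv_hom_id, complexBetti.map_id,
    CategoryTheory.id_apply]

/-- Contravariant functoriality on elements: `a^* (b^* z) = (a ≫ b)^* z`.
[cite: FultonYoungTableaux1997, Appendix B §B.1 (1)] -/
private theorem map_map_apply {X Y Z : SchemeOver ℂ} (a : X ⟶ Y) (b : Y ⟶ Z) (k : ℕ)
    (z : complexBetti Z k) :
    complexBetti.map a k (complexBetti.map b k z) = complexBetti.map (a ≫ b) k z := by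
  rw [complexBetti.map_comp, CategoryTheory.comp_apply]

/-! ### The stub -/

/-- **Stub 5 of line `semihomogeneous-perry-design` — HYPERBOLICITY IS CONSTANT ALONG A `√-7` WEIL FAMILY.**
Along a smooth projective family `f : 𝒳 ⟶ S` of relative dimension `6` over a smooth irreducible
quasi-projective base with a global endomorphism `g` over `S` and a global class `Θ ∈ H²(𝒳)` with rational
fibre restrictions, for two fibres with abelian charts `e : A ≅ 𝒳_s`, `e' : A' ≅ 𝒳_{s'}` intertwining `g`
with `φ`, `φ'` (`φ² = φ'² = -7`): if `(A, φ, e^*Θ_s)` is of HYPERBOLIC Weil type (`IsHyperbolicWeilType`: a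
rational `φ^*`-stable `6`-frame of `H¹` isotropic for `Q_h(x,y) = h⁵ ⌣ x ⌣ y`), so is `(A', φ', e'^*Θ_{s'})`.
Proof: `S(ℂ)` is a path-connected manifold, `R¹f_*ℂ` is a local system, and parallel transport along a path
from `s` to `s'` is an injective linear map `H¹(𝒳_s) → H¹(𝒳_{s'})` preserving rationality, intertwining
`g_s^*` with `g_{s'}^*`, and compatible with the polarization pairings of `Θ_s`, `Θ_{s'}` (restrictions of ONE
global class form a flat section); the charts `e, e'` move frames between `A, A'` and the fibres.
[cite: VoisinHodgeII2003, §3.1.2 (local systems and flat transport)]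
[cite: vanGeemen1994HodgeAV, 5.2–5.4 (hyperbolic = det H ≡ (-1)ⁿ)] -/
theorem stub_hyperbolicFlat :
    ∀ (𝒳 S : SchemeOver ℂ) (f : 𝒳 ⟶ S) (g : 𝒳 ⟶ 𝒳), IsSmoothProjectiveFamily f (2 * 3) → IrreducibleSpace S.left → AlgebraicGeometry.Smooth S.hom → IsQuasiProjectiveOver S → g ≫ f = f → ∀ (Θ : complexBetti 𝒳 2), (∀ s : ComplexPoints S, IsRationalClass (complexBetti.map (fiberι f s) 2 Θ)) → ∀ (s s' : ComplexPoints S) (A : AbelianVariety ℂ) (φ : A ⟶ A) (e : A.X ≅ fiberOver f s) (A' : AbelianVariety ℂ) (φ' : A' ⟶ A') (e' : A'.X ≅ fiberOver f s'), A.dim = 2 * 3 → A'.dim = 2 * 3 → φ ≫ φ = -((7 : ℤ) • 𝟙 A) → φ' ≫ φ' = -((7 : ℤ) • 𝟙 A') → (e.hom ≫ fiberι f s) ≫ g = φ.hom.hom.hom ≫ (e.hom ≫ fiberι f s) → (e'.hom ≫ fiberι f s') ≫ g = φ'.hom.hom.hom ≫ (e'.hom ≫ fiberι f s') → Literature.AlgebraicGeometry.Motives.IsHyperbolicWeilType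 A φ 3 (complexBetti.map e.hom 2 (complexBetti.map (fiberι f s) 2 Θ)) → Literature.AlgebraicGeometry.Motives.IsHyperbolicWeilType A' φ' 3 (complexBetti.map e'.hom 2 (complexBetti.map (fiberι f s') 2 Θ)) := by
  intro 𝒳 S f g hfam hirr hsm hSqp hg Θ _hΘ s s' A φ e A' φ' e' _hA _hA' _hφ _hφ' he he' hhyp
  -- the base: `S(ℂ)` is a path-connected manifold and `R• f_* ℂ` is a local system on it
  haveI := hsm
  haveI := hirr
  haveI : LocallyOfFiniteType S.hom := hSqp.locallyOfFiniteType
  haveI : ConnectedSpace (ComplexPoints S) :=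
    (Motives.ComplexPoints.connectedSpace_iff_holds S).2 inferInstance
  obtain ⟨d, hd⟩ := exists_smoothOfRelativeDimension_of_connectedSpace_complexPoints S
  haveI := hd
  haveI := pathConnectedSpace_complexPoints_of_smoothOfRelativeDimension S d
  have hU := isCohomologicallyLocallyTrivialOn_univ_of_isSmoothProjectiveFamily f d hfam hSqp
  -- the fibre maps of `g`
  choose gf hgf using fun t ↦ exists_fiberHom_comp_fiberι f g hg t
  -- view `s`, `s'` as points of the (trivialising) subset `univ ⊆ S(ℂ)` and join them by a path
  obtain ⟨xs, rfl⟩ : ∃ xs : (Set.univ : Set (ComplexPoints S)), (xs : ComplexPoints S) = s :=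
    ⟨⟨s, Set.mem_univ s⟩, rfl⟩
  obtain ⟨xs', rfl⟩ : ∃ xs' : (Set.univ : Set (ComplexPoints S)), (xs' : ComplexPoints S) = s' :=
    ⟨⟨s', Set.mem_univ s'⟩, rfl⟩
  haveI : PathConnectedSpace (Set.univ : Set (ComplexPoints S)) :=
    isPathConnected_iff_pathConnectedSpace.1 (pathConnectedSpace_iff_univ.1 inferInstance)
  let γ : Path xs xs' := PathConnectedSpace.somePath xs xs'
  -- the transport `L := e'^* ∘ γ_* ∘ e^{-1 *} : H¹(A) → H¹(A')`, an injective linear map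
  obtain ⟨L, hL⟩ : ∃ L : complexBetti A.X 1 →ₗ[ℂ] complexBetti A'.X 1, ∀ x, L x =
      complexBetti.map e'.hom 1 (transportFun f 1 hU ⟦γ⟧ (complexBetti.map e.inv 1 x)) :=
    ⟨(complexBetti.map e'.hom 1).hom ∘ₗ transportLinear f 1 hU ⟦γ⟧ ∘ₗ (complexBetti.map e.inv 1).hom,
      fun x ↦ rfl⟩
  have heg : e.hom ≫ gf xs = φ.hom.hom.hom ≫ e.hom :=
    hom_comp_fiberHom_eq_of_comp_fiberι f g (hgf xs) e φ.hom.hom.hom he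
  have heg' : e'.hom ≫ gf xs' = φ'.hom.hom.hom ≫ e'.hom :=
    hom_comp_fiberHom_eq_of_comp_fiberι f g (hgf xs') e' φ'.hom.hom.hom he'
  have hinjB : Function.Injective (complexBetti.map e.inv 1) :=
    Function.LeftInverse.injective (g := complexBetti.map e.hom 1) fun x ↦ map_hom_map_inv_apply e 1 x
  have hinjA : Function.Injective (complexBetti.map e'.hom 1) :=
    Function.LeftInverse.injective (g := complexBetti.map e'.inv 1) fun y ↦ map_inv_map_hom_apply e' 1 y
  have hinjT := transportFun_injective f 1 hU ⟦γ⟧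
  have hLinj : Function.Injective L := by
    intro x y hxy
    rw [hL, hL] at hxy
    exact hinjB (hinjT (hinjA hxy))
  -- the hyperbolic frame on `A` and its transport `L ∘ u` to `A'`
  obtain ⟨u, hrat, hind, hstab, hiso⟩ := hhyp
  refine ⟨fun i ↦ L (u i), fun i ↦ ?_, hind.map_injOn L hLinj.injOn, fun i ↦ ?_, fun i j ↦ ?_⟩
  · -- rationality: `e^{-1 *}`, `γ_*`, `e'^*` preserve rational classes
    beta_reduce
    rw [hL]
    exact (isRationalClass_transportFun_of_isSmoothProjectiveFamily f 1 d hfam hSqp ⟦γ⟧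
      ((hrat i).map (Motives.AlgPoints.mapContinuous (L := ℂ) e.inv))).map
        (Motives.AlgPoints.mapContinuous (L := ℂ) e'.hom)
  · -- `φ'^*`-stability: `φ'^* (L uᵢ) = L (φ^* uᵢ)` and `L` is linear
    beta_reduce
    have hcomp : gf xs ≫ e.inv = e.inv ≫ φ.hom.hom.hom := by
      rw [Iso.comp_inv_eq, Category.assoc, ← heg, Iso.inv_hom_id_assoc]
    have h1 : complexBetti.map (gf xs) 1 (complexBetti.map e.inv 1 (u i)) =
        complexBetti.map e.inv 1 (complexBetti.map φ.hom.hom.hom 1 (u i)) := by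
      rw [map_map_apply, map_map_apply, hcomp]
    have h2 : transportFun f 1 hU ⟦γ⟧ (complexBetti.map (gf xs) 1 (complexBetti.map e.inv 1 (u i))) =
        complexBetti.map (gf xs') 1 (transportFun f 1 hU ⟦γ⟧ (complexBetti.map e.inv 1 (u i))) :=
      transportFun_map_fiberHom f 1 hU g hg gf hgf ⟦γ⟧ _
    have h3 : ∀ y, complexBetti.map φ'.hom.hom.hom 1 (complexBetti.map e'.hom 1 y) =
        complexBetti.map e'.hom 1 (complexBetti.map (gf xs') 1 y) := fun y ↦ by
      rw [map_map_apply, map_map_apply, heg']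
    have key : complexBetti.map φ'.hom.hom.hom 1 (L (u i)) =
        L (complexBetti.map φ.hom.hom.hom 1 (u i)) := by
      rw [hL, hL, h3, ← h2, h1]
    have hrange : Set.range (fun i ↦ L (u i)) = L '' Set.range u := Set.range_comp L u
    rw [key, hrange, Submodule.span_image]
    exact Submodule.mem_map_of_mem (hstab i)
  · -- isotropy: `Q_{e'^*Θ_{s'}}(L uᵢ, L uⱼ) = e'^* γ_* e^{-1 *} Q_{e^*Θ_s}(uᵢ, uⱼ) = 0`
    beta_reduce
    rw [hL, hL, ← map_polarizationPairingOne]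
    have h4 : polarizationPairingOne (fiberOver f xs') (complexBetti.map (fiberι f xs') 2 Θ) (2 * 3 - 1)
          (transportFun f 1 hU ⟦γ⟧ (complexBetti.map e.inv 1 (u i)))
          (transportFun f 1 hU ⟦γ⟧ (complexBetti.map e.inv 1 (u j))) =
        transportFun f (2 + 2 * (2 * 3 - 1)) hU ⟦γ⟧
          (polarizationPairingOne (fiberOver f xs) (complexBetti.map (fiberι f xs) 2 Θ) (2 * 3 - 1)
            (complexBetti.map e.inv 1 (u i)) (complexBetti.map e.inv 1 (u j))) :=
      (transportFun_polarizationPairingOne f hU Θ ⟦γ⟧ (2 * 3 - 1) _ _).symm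
    have h5 : polarizationPairingOne (fiberOver f xs) (complexBetti.map (fiberι f xs) 2 Θ) (2 * 3 - 1)
          (complexBetti.map e.inv 1 (u i)) (complexBetti.map e.inv 1 (u j)) = 0 := by
      have h6 : complexBetti.map (fiberι f xs) 2 Θ =
          complexBetti.map e.inv 2 (complexBetti.map e.hom 2 (complexBetti.map (fiberι f xs) 2 Θ)) :=
        (map_inv_map_hom_apply e 2 _).symm
      rw [h6, ← map_polarizationPairingOne, hiso i j, map_zero]
    rw [h4, h5, transportFun_zero, map_zero]

end Summit.HodgeConjecture.HodgeConjecture.Theorems.HeckePrymWeilLine.SemihomogeneousPerryDesign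

end
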